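import Mathlib
import Summits.CriticalPhenomena.PercolationContinuityZ3.Theses.PercNonProliferation
import HarnessLib

/-!
# Route `PercNonProliferation` — support `PolynomialPairGivesSparse` (item `stmt-CriticalPhenomena-14737`)

Settles the route decl
`Summit.CriticalPhenomena.PercolationContinuityZ3.Theses.PercNonProliferation.PolynomialPairGivesSparse`:

  `FreeBoxPowerSaving → SubpolynomialBlocking → FreeBoxSparse`.

Pure real analysis (a squeeze), no percolation input: writing
`F(n) = |B(n)|⁻² Σ_{x,y ∈ B(n)} P_{p_c}(x ↔ y inside B(n))` for the free-box pair average,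
`FreeBoxPowerSaving` gives `a > 0` and `C` with `F(n) ≤ C · n^{-a}` for `n ≥ 1`, while `F(n) ≥ 0`
(a double sum of probabilities over a square). Since `n^{-a} → 0` (`tendsto_rpow_neg_atTop` along
`ℕ → ℝ`), `0 ≤ F(n) ≤ C · n^{-a} → 0` forces `F(n) → 0`, which is `FreeBoxSparse`. The hypothesis
`SubpolynomialBlocking` is idle here (the pair's other use, `PolynomialAssembly`, is where it works).
-/

namespace Summit.CriticalPhenomena.PercolationContinuityZ3.Theorems

open MeasureTheory Filter Topology
open Summit.CriticalPhenomena.PercolationContinuityZ3.Theses.PercNonProliferation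

/-- Abstract squeeze behind `PolynomialPairGivesSparse`: a nonnegative real sequence dominated by
`C · n^{-a}` (`a > 0`) from `n = 1` on tends to `0`. -/
theorem polynomialPairGivesSparse_squeeze {F : ℕ → ℝ} (hF0 : ∀ n, 0 ≤ F n) {a C : ℝ} (ha : 0 < a)
    (hFC : ∀ n : ℕ, 1 ≤ n → F n ≤ C * (n : ℝ) ^ (-a)) :
    Tendsto F atTop (𝓝 0) := by
  have hpow : Tendsto (fun n : ℕ => C * (n : ℝ) ^ (-a)) atTop (𝓝 0) := by
    have h := (tendsto_rpow_neg_atTop ha).comp tendsto_natCast_atTop_atTop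
    simpa using h.const_mul C
  refine tendsto_of_tendsto_of_tendsto_of_le_of_le' tendsto_const_nhds hpow
    (Eventually.of_forall hF0) ?_
  filter_upwards [eventually_ge_atTop 1] with n hn
  exact hFC n hn

/-- `PolynomialPairGivesSparse`: the power saving for the free-box pair average at `p_c(ℤ³)` already
forces the pair average to vanish (`FreeBoxSparse`); `SubpolynomialBlocking` is not needed. -/
theorem polynomialPairGivesSparse_proof : PolynomialPairGivesSparse := by
  unfold PolynomialPairGivesSparse
  intro hFPS _hSB
  unfold FreeBoxPowerSaving at hFPS
  unfold FreeBoxSparse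
  obtain ⟨a, C, ha, hC⟩ := hFPS
  refine polynomialPairGivesSparse_squeeze (fun n => ?_) ha hC
  exact div_nonneg (Finset.sum_nonneg fun x _ => Finset.sum_nonneg fun y _ => measureReal_nonneg)
    (sq_nonneg _)

end Summit.CriticalPhenomena.PercolationContinuityZ3.Theorems
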